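import Summits.HodgeConjecture.CorCM.GaloisTwoPowerDescentLemmas
import HarnessLib

/-!
# Structure lemmas for the descent of the `2`-power classification: the product structure `H × E` of a CM quotient makes its
# involutions central

COR-CM (cell `pub-hodgecm2`), binder seat b04 (gen 35), count-neutral own lane «Galois-CM-type classification».  KERNEL ONLY:
theorems; no definition, no named fact, no `sorry`.  `HC_CM` is neither used nor claimed.  Tools for
`CorCM/GaloisTwoPowerOrderFourDescent` and `CorCM/GaloisTwoPowerClassification` (same session).

STRUCT(`K`) denotes the conclusion of gen 34's (R1) `CorCM/GaloisTwoPowerOrderFourClassification`: `Gal(K/ℚ) = H·E` with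
`H.IsComplement' E`, `E` central of exponent `2`, `|E| ≤ 2`, complex conjugation `c ∈ H ∖ E`, `|H| = 2^k`, `H` cyclic or
`≃ QuaternionGroup (2^(k-2))` (i.e. `Gal(K/ℚ) ∈ {C, Q, C × C₂, Q × C₂}`); GOOD = every primitive CM type nondegenerate.

* §1 (Mathlib only) the subgroup `⟨t⟩` of an involution `t`: membership, normality for central `t`, order `2`, index.
* §2 (Mathlib only) **`comm_of_isComplement'_of_mul_self_eq_one`** — in `G = H·E` as above (`H ∋ c` cyclic or generalised quaternion,
  `E` central of exponent `2`) every involution is central (it lies in `E ∪ cE`).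
* §3 (Mathlib only) **`exists_sq_eq_and_ne_of_dicyclic_lift`** — the pure group core of gen 35's
  `CorCM/GaloisTwoPowerDescentLemmas.exists_simple_degenerate_of_dicyclic_lift`: for `t = y²` and `c` central involutions, `a⁴ ≠ 1`,
  `a y a⁻¹ = t y`, `x² ∈ {c, tc}`, `x a x⁻¹ ∈ {a⁻¹, t a⁻¹}`, `x y x⁻¹ ∈ {y, t y}`, some `w ∈ {x, xa, xy, xay}` has `w² = tc` and
  `(a w)(w a)⁻¹ ∉ {1, tc}` — an involution of `G/⟨tc⟩` not commuting with the image of `a`.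
* §4 **`mul_comm_mod_of_struct`** — `K` GOOD, `N ◁ Gal(K/ℚ)` with `c ∉ N ≠ 1`; if every GOOD Galois CM field of degree `[Gal:N]` has
  STRUCT, then every `w` with `w² ∈ N` satisfies `(g w)(w g)⁻¹ ∈ N` for all `g` (the involution `wN` of `Gal(K^N/ℚ) ≅ Gal/N` is
  central) — the size-free replacement of gen 34's quotient criterion (`CorCM/GaloisQuotientNonCentralInvolution`, `[Gal:N] ≥ 52`)
  used by the descent below degree `128`.

## References

* [Rotman1995] J. J. Rotman, *An Introduction to the Theory of Groups*, 4th ed., GTM 148, Springer 1995, Thm. 5.46.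
* [Shimura1998] G. Shimura, *Abelian Varieties with Complex Multiplication and Modular Functions*, §8.2 Prop. 26, §18.2.
* [Kubota1965] T. Kubota, *On the field extension by complex multiplication*, Trans. AMS 118 (1965), §2 and §4 Lemma 2.
-/

noncomputable section

open CategoryTheory CategoryTheory.Limits NumberField
open scoped BigOperators

namespace Summit.HodgeConjecture.CorCM.GaloisModels

open Literature.NumberTheory.ComplexMultiplication
open Literature.AlgebraicGeometry.Motives (AbelianVariety CMType)
open Literature.AlgebraicGeometry.HodgeTheory
open Literature.AlgebraicGeometry.Pohlmann1968
open Summit.HodgeConjecture.CorCM.GaloisRank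

section Group

variable {G : Type*} [Group G]

/-! ## §1 The subgroup generated by an involution -/

/-- `t² = 1` ⟹ `⟨t⟩ = {1, t}`. [folklore] -/
theorem mem_zpowers_iff_of_mul_self_eq_one {t : G} (htt : t * t = 1) (σ : G) :
    σ ∈ Subgroup.zpowers t ↔ σ = 1 ∨ σ = t := by
  refine ⟨fun h => ?_, ?_⟩
  · obtain ⟨i, rfl⟩ := Subgroup.mem_zpowers_iff.1 h
    exact zpow_eq_one_or_eq_of_mul_self_eq_one htt i
  · rintro (h | h) <;> rw [h]
    · exact (Subgroup.zpowers t).one_mem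
    · exact Subgroup.mem_zpowers t

/-- The cyclic subgroup of a central element is normal. [folklore] -/
theorem normal_zpowers_of_forall_comm {t : G} (htcen : ∀ g : G, g * t = t * g) : (Subgroup.zpowers t).Normal := by
  refine ⟨fun σ hσ g => ?_⟩
  obtain ⟨i, rfl⟩ := Subgroup.mem_zpowers_iff.1 hσ
  rw [((show Commute g t from htcen g).zpow_right i).eq, mul_inv_cancel_right]
  exact Subgroup.zpow_mem _ (Subgroup.mem_zpowers t) i

/-- `t² = 1 ≠ t` ⟹ `|⟨t⟩| = 2`. [folklore] -/
theorem card_zpowers_of_mul_self_eq_one {t : G} (htt : t * t = 1) (ht1 : t ≠ 1) : Nat.card (Subgroup.zpowers t) = 2 := by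
  rw [Nat.card_zpowers]
  exact orderOf_eq_prime (by rw [pow_two, htt]) ht1

/-- `t² = 1 ≠ t` in a finite group ⟹ `[G : ⟨t⟩] · 2 = |G|`. [folklore] -/
theorem index_zpowers_mul_two [Finite G] {t : G} (htt : t * t = 1) (ht1 : t ≠ 1) :
    (Subgroup.zpowers t).index * 2 = Nat.card G := by
  rw [← card_zpowers_of_mul_self_eq_one htt ht1]
  exact (Subgroup.zpowers t).index_mul_card

/-! ## §2 Involutions of `H·E` -/

/-- **In `G = H·E` with `E` central of exponent `2`, `H ∋ c` (`c` a central involution) cyclic or generalised quaternion of order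
`2^k`, every involution is central** (it is `e` or `c e` with `e ∈ E`). [cite: Rotman1995, Thm. 5.46] -/
theorem comm_of_isComplement'_of_mul_self_eq_one [Finite G] (H E : Subgroup G) (hHE : H.IsComplement' E) {c : G} (hcH : c ∈ H)
    (hcc : c * c = 1) (hc1 : c ≠ 1) (hccen : ∀ g : G, g * c = c * g) (hE : ∀ e ∈ E, e * e = 1 ∧ ∀ g : G, g * e = e * g)
    {k : ℕ} (hHcard : Nat.card H = 2 ^ k) (hstruct : IsCyclic H ∨ (3 ≤ k ∧ Nonempty (H ≃* QuaternionGroup (2 ^ (k - 2)))))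
    (s : G) (hss : s * s = 1) (g : G) : g * s = s * g := by
  classical
  -- every involution of `H` is `c`
  have hinv : ∀ s' ∈ H, s' * s' = 1 → s' ≠ 1 → s' = c := by
    rcases hstruct with hcyc | ⟨-, ⟨f⟩⟩
    · obtain ⟨gH, hgH⟩ := IsCyclic.exists_generator (α := H)
      have hog : orderOf (gH : G) = 2 ^ k := by rw [Subgroup.orderOf_coe, orderOf_eq_card_of_forall_mem_zpowers hgH, hHcard]
      have hmem : ∀ s' : G, s' ∈ H → s' ∈ Subgroup.zpowers (gH : G) := by
        intro s' hs'
        obtain ⟨i, hi⟩ := Subgroup.mem_zpowers_iff.1 (hgH ⟨s', hs'⟩)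
        exact Subgroup.mem_zpowers_iff.2 ⟨i, by rw [← Subgroup.coe_zpow, hi]⟩
      intro s' hs' hss' hs1'
      exact involution_eq_of_mem_zpowers hog (hmem s' hs') hss' hs1' (hmem c hcH) hcc hc1
    · haveI : NeZero (2 ^ (k - 2)) := ⟨by positivity⟩
      obtain ⟨a', -, -, -, -, -, -, -, hinvol⟩ := exists_index_two_data_of_mulEquiv_quaternionGroup H f
      intro s' hs' hss' hs1'
      rw [hinvol s' hs' hss' hs1', ← hinvol c hcH hcc hc1]
  -- `s = h e` with `h² = 1`
  obtain ⟨⟨h, e⟩, hhe⟩ := hHE.2 s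
  change (h : G) * e = s at hhe
  have heh : (h : G) * e = e * h := ((hE e e.2).2 h)
  have hhh : (h : G) * h = 1 := by
    have : s * s = (h : G) * h * (e * e) := by
      rw [← hhe]
      calc (h : G) * e * (h * e) = h * (e * h) * e := by group
        _ = h * (h * e) * e := by rw [← heh]
        _ = h * h * (e * e) := by group
    rw [← hss, this, (hE e e.2).1, mul_one]
  by_cases h1 : (h : G) = 1
  · rw [← hhe, h1, one_mul]
    exact (hE e e.2).2 g
  · rw [← hhe, hinv h h.2 hhh h1, ← mul_assoc, hccen g, mul_assoc, (hE e e.2).2 g, ← mul_assoc]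

/-! ## §3 The dicyclic-lift commutator -/

/-- **LIFTED DICYCLIC RELATIONS, group core.**  `t = y²` and `c` central involutions, `a⁴ ≠ 1`, `a y a⁻¹ = t y`, `x² ∈ {c, t c}`,
`x a x⁻¹ ∈ {a⁻¹, t a⁻¹}`, `x y x⁻¹ ∈ {y, t y}` ⟹ some `w` (one of `x, x a, x y, x a y`) has `w² = t c` and
`(a w)(w a)⁻¹ ∉ {1, t c}` (it equals `a²` or `a² t`). [folklore] -/
theorem exists_sq_eq_and_ne_of_dicyclic_lift {a x y t c : G} (ht : t = y * y) (htt : t * t = 1) (hcc : c * c = 1)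
    (hccen : ∀ g : G, g * c = c * g) (htcen : ∀ g : G, g * t = t * g) (ha4 : a ^ 4 ≠ 1) (hya : a * y * a⁻¹ = t * y)
    (hxx : x * x = c ∨ x * x = t * c) (hxa : x * a * x⁻¹ = a⁻¹ ∨ x * a * x⁻¹ = t * a⁻¹)
    (hxy : x * y * x⁻¹ = y ∨ x * y * x⁻¹ = t * y) :
    ∃ w : G, w * w = t * c ∧ (a * w) * (w * a)⁻¹ ≠ 1 ∧ (a * w) * (w * a)⁻¹ ≠ t * c := by
  have htcsq : t * c * (t * c) = 1 := by
    calc t * c * (t * c) = t * (c * t) * c := by group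
      _ = t * (t * c) * c := by rw [← hccen t]
      _ = (t * t) * (c * c) := by group
      _ = 1 := by rw [htt, hcc, one_mul]
  -- `a² ∉ {1, t, c, t c}` since `a⁴ ≠ 1`
  have hsq_ne : ∀ s : G, s * s = 1 → a * a ≠ s := by
    intro s hss h'
    exact ha4 (by rw [show (4 : ℕ) = 2 + 2 by norm_num, pow_add, pow_two, h', hss])
  -- the commutator `a x a⁻¹ x⁻¹ ∈ {a², a² t}` and conjugation facts
  have hκx : a * x * a⁻¹ * x⁻¹ = a * a ∨ a * x * a⁻¹ * x⁻¹ = a * a * t := by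
    rcases hxa with h | h
    · left
      calc a * x * a⁻¹ * x⁻¹ = a * (x * a * x⁻¹)⁻¹ := by group
        _ = a * a := by rw [h, inv_inv]
    · right
      calc a * x * a⁻¹ * x⁻¹ = a * (x * a * x⁻¹)⁻¹ := by group
        _ = a * (a * t⁻¹) := by rw [h, mul_inv_rev, inv_inv]
        _ = a * a * t := by rw [inv_eq_of_mul_eq_one_right htt, mul_assoc]
  have hxt : x * t * x⁻¹ = t := by rw [htcen x, mul_inv_cancel_right]
  have hat : a * t * a⁻¹ = t := by rw [htcen a, mul_inv_cancel_right]
  have hya_inv : y * a⁻¹ * y⁻¹ = a⁻¹ * t := by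
    calc y * a⁻¹ * y⁻¹ = a⁻¹ * (a * y * a⁻¹) * y⁻¹ := by group
      _ = a⁻¹ * (t * y) * y⁻¹ := by rw [hya]
      _ = a⁻¹ * t := by group
  -- it suffices to find `w` with `w² = t c` and `a w a⁻¹ w⁻¹ ∈ {a x a⁻¹ x⁻¹, a x a⁻¹ x⁻¹ t}`
  suffices hw : ∃ w : G, w * w = t * c ∧
      (a * w * a⁻¹ * w⁻¹ = a * x * a⁻¹ * x⁻¹ ∨ a * w * a⁻¹ * w⁻¹ = a * x * a⁻¹ * x⁻¹ * t) by
    obtain ⟨w, hww, hw⟩ := hw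
    have hv : a * w * a⁻¹ * w⁻¹ = a * a ∨ a * w * a⁻¹ * w⁻¹ = a * a * t := by
      rcases hw with h1 | h1 <;> rcases hκx with h2 | h2
      · exact Or.inl (h1.trans h2)
      · exact Or.inr (h1.trans h2)
      · exact Or.inr (by rw [h1, h2])
      · exact Or.inl (by rw [h1, h2, mul_assoc (a * a), htt, mul_one])
    have hform : a * w * (w * a)⁻¹ = a * w * a⁻¹ * w⁻¹ := by rw [mul_inv_rev, ← mul_assoc]
    refine ⟨w, hww, ?_, ?_⟩
    · rw [hform]
      rcases hv with hv | hv <;> rw [hv]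
      · exact hsq_ne 1 (mul_one 1)
      · intro h
        rw [mul_eq_one_iff_eq_inv, inv_eq_of_mul_eq_one_right htt] at h
        exact hsq_ne t htt h
    · rw [hform]
      rcases hv with hv | hv <;> rw [hv]
      · exact hsq_ne _ htcsq
      · intro h
        rw [hccen t] at h
        exact hsq_ne c hcc (mul_right_cancel h)
  -- the four candidates
  rcases hxx with hxx | hxx
  · rcases hxa with hxa | hxa
    · rcases hxy with hxy | hxy
      · -- `w = x y`
        have hcxy : x * y = y * x := mul_inv_eq_iff_eq_mul.1 hxy
        refine ⟨x * y, ?_, Or.inr ?_⟩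
        · calc x * y * (x * y) = x * (y * x) * y := by group
            _ = x * (x * y) * y := by rw [← hcxy]
            _ = (x * x) * (y * y) := by group
            _ = c * t := by rw [hxx, ← ht]
            _ = t * c := (hccen t).symm
        · calc a * (x * y) * a⁻¹ * (x * y)⁻¹ = a * x * (y * a⁻¹ * y⁻¹) * x⁻¹ := by group
            _ = a * x * (a⁻¹ * t) * x⁻¹ := by rw [hya_inv]
            _ = (a * x * a⁻¹ * x⁻¹) * (x * t * x⁻¹) := by group
            _ = a * x * a⁻¹ * x⁻¹ * t := by rw [hxt]
      · -- `w = x a y`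
        have hu : x * a * y = y * (x * a) := by
          calc x * a * y = (x * (a * y * a⁻¹) * x⁻¹) * (x * a) := by group
            _ = (x * (t * y) * x⁻¹) * (x * a) := by rw [hya]
            _ = ((x * t * x⁻¹) * (x * y * x⁻¹)) * (x * a) := by group
            _ = (t * (t * y)) * (x * a) := by rw [hxt, hxy]
            _ = y * (x * a) := by rw [← mul_assoc t t y, htt, one_mul]
        have huu : x * a * (x * a) = c := by
          calc x * a * (x * a) = (x * a * x⁻¹) * (x * x) * a := by group
            _ = a⁻¹ * c * a := by rw [hxa, hxx]
            _ = a⁻¹ * (a * c) := by rw [mul_assoc, ← hccen a]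
            _ = c := by group
        refine ⟨x * a * y, ?_, Or.inr ?_⟩
        · calc x * a * y * (x * a * y) = (x * a) * (y * (x * a)) * y := by group
            _ = (x * a) * ((x * a) * y) * y := by rw [← hu]
            _ = (x * a * (x * a)) * (y * y) := by group
            _ = c * t := by rw [huu, ← ht]
            _ = t * c := (hccen t).symm
        · calc a * (x * a * y) * a⁻¹ * (x * a * y)⁻¹ = a * x * a * (y * a⁻¹ * y⁻¹) * a⁻¹ * x⁻¹ := by group
            _ = a * x * a * (a⁻¹ * t) * a⁻¹ * x⁻¹ := by rw [hya_inv]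
            _ = (a * x * a⁻¹ * x⁻¹) * (x * (a * t * a⁻¹) * x⁻¹) := by group
            _ = (a * x * a⁻¹ * x⁻¹) * (x * t * x⁻¹) := by rw [hat]
            _ = a * x * a⁻¹ * x⁻¹ * t := by rw [hxt]
    · -- `w = x a`
      refine ⟨x * a, ?_, Or.inl (by group)⟩
      calc x * a * (x * a) = (x * a * x⁻¹) * (x * x) * a := by group
        _ = t * a⁻¹ * c * a := by rw [hxa, hxx]
        _ = t * (a⁻¹ * (c * a)) := by group
        _ = t * (a⁻¹ * (a * c)) := by rw [← hccen a]
        _ = t * c := by group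
  · -- `w = x`
    exact ⟨x, hxx, Or.inl rfl⟩

end Group

/-! ## §4 STRUCT of a CM quotient makes its involutions central -/

section Field

variable {K : Type} [Field K] [NumberField K] [IsCMField K] [IsGalois ℚ K]

/-- **Involutions of a structured CM quotient are central.**  `K` Galois CM, GOOD; `N ◁ Gal(K/ℚ)` with complex conjugation `∉ N`,
`N ≠ 1`; suppose every GOOD Galois CM field `K'` of degree `[Gal(K/ℚ):N]` has `Gal(K'/ℚ) = H·E` (`H.IsComplement' E`, `E` central of
exponent `2`, `|E| ≤ 2`, `c' ∈ H ∖ E`, `|H| = 2^k`, `H` cyclic or `≃ QuaternionGroup (2^(k-2))`).  Then for every `w ∈ Gal(K/ℚ)` with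
`w² ∈ N`: `(g w)(w g)⁻¹ ∈ N` for all `g` (applied to the GOOD Galois CM subfield `K^N`, whose Galois group is `Gal/N`).
[cite: Kubota1965, §2 and §4 Lemma 2] [cite: Shimura1998, §8.2 Prop. 26 and §18.2] [cite: Rotman1995, Thm. 5.46] -/
theorem mul_comm_mod_of_struct (N : Subgroup (K ≃ₐ[ℚ] K)) [N.Normal] (hc : (IsCMField.complexConj K).restrictScalars ℚ ∉ N)
    (hN : N ≠ ⊥) (hgood : ∀ (Φ : CMType K) (φ : K →+* ℂ), IsPrimitive (ℂ ≃+* ℂ) Φ.1 φ → IsNondegenerate Φ)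
    (hS : ∀ (K' : Type) [Field K'] [NumberField K'] [IsCMField K'] [IsGalois ℚ K'],
      Module.finrank ℚ K' = N.index →
      (∀ (Φ : CMType K') (φ : K' →+* ℂ), IsPrimitive (ℂ ≃+* ℂ) Φ.1 φ → IsNondegenerate Φ) →
      ∃ (H E : Subgroup (K' ≃ₐ[ℚ] K')) (k : ℕ), H.IsComplement' E ∧ (IsCMField.complexConj K').restrictScalars ℚ ∈ H ∧
        (IsCMField.complexConj K').restrictScalars ℚ ∉ E ∧ (∀ e ∈ E, e * e = 1 ∧ ∀ g : K' ≃ₐ[ℚ] K', g * e = e * g) ∧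
        Nat.card E ≤ 2 ∧ Nat.card H = 2 ^ k ∧ (IsCyclic H ∨ (3 ≤ k ∧ Nonempty (H ≃* QuaternionGroup (2 ^ (k - 2))))))
    (w g : K ≃ₐ[ℚ] K) (hww : w * w ∈ N) : (g * w) * (w * g)⁻¹ ∈ N := by
  classical
  set K' := IntermediateField.fixedField N with hK'
  haveI : IsCMField K' := isCMField_fixedField_of_not_mem N hc
  haveI : IsGalois ℚ K' := IsGalois.of_fixedField_normal_subgroup N
  set res := AlgEquiv.restrictNormalHom (F := ℚ) (K₁ := K) K' with hres
  have hkerN : res.ker = N :=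
    (IntermediateField.restrictNormalHom_ker K').trans (IntermediateField.fixingSubgroup_fixedField N)
  have hker : ∀ σ : K ≃ₐ[ℚ] K, res σ = 1 ↔ σ ∈ N := by
    intro σ
    rw [← MonoidHom.mem_ker, hkerN]
  set c' := (IsCMField.complexConj K').restrictScalars ℚ with hc'
  have hc'c' : c' * c' = 1 := model_complexConj_mul_self (MulEquiv.refl (K' ≃ₐ[ℚ] K')) (by simp [hc'])
  have hc'1 : c' ≠ 1 := model_complexConj_ne_one (MulEquiv.refl (K' ≃ₐ[ℚ] K')) (by simp [hc'])
  have hc'cen : ∀ γ : K' ≃ₐ[ℚ] K', γ * c' = c' * γ := fun γ =>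
    (model_complexConj_comm (MulEquiv.refl (K' ≃ₐ[ℚ] K')) (by simp [hc']) γ).symm
  have hgood' : ∀ (Φ : CMType K') (φ : K' →+* ℂ), IsPrimitive (ℂ ≃+* ℂ) Φ.1 φ → IsNondegenerate Φ :=
    fun Φ φ hprim => isNondegenerate_of_isPrimitive_of_fixedField_of_ne_bot N hc hN hgood Φ φ hprim
  have hdeg' : Module.finrank ℚ K' = N.index := by rw [hK', finrank_fixedField_eq_index]
  obtain ⟨H', E', k, hHE, hcH, -, hE, -, hHcard, hstruct⟩ := hS K' hdeg' hgood'
  have hs : res w * res w = 1 := by rw [← map_mul]; exact (hker _).2 hww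
  have hcomm := comm_of_isComplement'_of_mul_self_eq_one H' E' hHE hcH hc'c' hc'1 hc'cen hE hHcard hstruct (res w) hs (res g)
  refine (hker _).1 ?_
  rw [map_mul, map_inv, map_mul, map_mul, hcomm, mul_inv_cancel]

end Field

end Summit.HodgeConjecture.CorCM.GaloisModels
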